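import Mathlib
import HarnessLib
import Summits.HubbardSuperconductivity.HubbardSuperconductivity.Theorems.KLProgrammeKLRegimeEngineV8PairTransferRelBarIdx

/-!
# Route `KLProgramme` — ENGINE child gen 8 (stmt-HubbardSuperconductivity-20437 `KLRegimeEngineV17F2`), skeleton v2 class #5 «(S)-transfer» rev 3 (RELATIVE family,
# INDEX-keyed, plan g21 (R54ab)): KEYED WEIGHT-MASS LINES for the (c) closer (cell gate-hubbard-kl, seat hubbard-kl-p1 g13 = class-#5 text owner; EdgeFacts lane, on demand)

The relative step `pairTransferRelAt_succ` (p586440) at the pair `(s_{n+1,m} | s_{n+1,m′})` consumes, besides the room `transferBarRelIdx_succ_room` (p590284), three MASS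
LINES of the relative pinned weight `a = −(t[ψ₁] − t[ψ₂]) = −t[ψ₁ − ψ₂]` keyed on the INDEX weights: at the START of the flows (frame `K_{n+1}`, cutoff scale `n`), at their
END (frame `K_{n+1}`, scale `n+1`), and the smallness `m·Σ|a| ≤ 1/3`.  All are p585429's `sum_abs_klTransferWeight[_sub]_le_klSoftMass` followed by the frame-free
majorant `klSoftMass_compl_sub_compl_le_klIdxMass` (p590284) — stated for an ARBITRARY admissible frame `K` (so the same lemma serves the history frame `Kₙ` and the
flows' frame `K_{n+1}`):
* `sum_abs_klTransferWeight_compl_sub_compl_le` — `Σ_p |tₙ^K[s_{n,m} − s_{n,m′}](Qm,p)| ≤ 4·klIdxMass n m′` (`n ≤ m′ ≤ m`);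
* `sum_abs_klTransferWeight_compl_sub_le` — the same for the difference of the two members' weights `tₙ^K[s_{n,m}] − tₙ^K[s_{n,m′}]`;
* `mul_sum_abs_klTransferWeight_compl_sub_le_third` — `m·Σ_p|…| ≤ 1/3` from `m·(4·15367) ≤ 1/3` (the U-door's smallness);
* base-scale readings `klIdxPrefactor_zero` (`= r`), `klIdxMass_zero` (`= 15367·(4^{m′})⁻¹`), `transferBarRelIdx_zero` (the n = 0 bar k3c2-p1's base clause carries).
* §3 dispatch of the trivial pairs: `softSymbolCompl_eq_of_nScales_lt` (Wick degeneracy), `pairTransferRelAt_relIdx_refl` / `_of_eq` (diagonal / equal-member pairs are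
  free by `PairTransferRelAt.refl`, the index bar being nonnegative).
Bookkeeping only; nothing about the model is asserted.  0 kit · 0 lit.
-/

noncomputable section

namespace Summit.HubbardSuperconductivity.HubbardSuperconductivity.Theorems.KLRegimeSplit

set_option linter.dupNamespace false -- summit = problem name (single-conjunct summit), D-0017

open Real Finset Literature.MathematicalPhysics.QuantumLattice Literature.Probability.LatticeModels
open Summit.HubbardSuperconductivity.HubbardSuperconductivity.Theorems.KLProgrammeLegKernels

/-! ## §1 Keyed mass lines of the relative pinned weight -/

section Lines

variable {L M : ℕ} [NeZero L] (β μ : ℝ) (K : TrigPolyC4v) {R : RenConsts} {U : ℝ} {N : ℕ}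

/-- **Mass of the relative pinned weight, index-keyed**: for the pair `(s_{n,m} | s_{n,m′})` of an admissible frame `K` (`FrameOK`, `klBetaMin ≤ β ≤ L`, `n ≤ m′ ≤ m`),
`Σ_p |tₙ^K[s_{n,m} − s_{n,m′}](Qm, p)| ≤ 4·klIdxMass n m′`. -/
theorem sum_abs_klTransferWeight_compl_sub_compl_le (hK : FrameOK R U N μ K) (hβ : klBetaMin ≤ β) (hβL : β ≤ L) {n m m' : ℕ} (hn : n ≤ m') (h : m' ≤ m)
    (Qm : TorusSite 2 L) :
    ∑ p, |klTransferWeight L M β μ K n (softSymbolCompl L M β μ K n m - softSymbolCompl L M β μ K n m') Qm p| ≤ 4 * klIdxMass n m' :=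
  (sum_abs_klTransferWeight_le_klSoftMass β μ K (pos_of_klBetaMin_le hβ) n _ Qm).trans
    (mul_le_mul_of_nonneg_left (klSoftMass_compl_sub_compl_le_klIdxMass β μ K hK hβ hβL hn h) (by norm_num))

/-- The same for the DIFFERENCE OF THE TWO MEMBERS' WEIGHTS: `Σ_p |tₙ^K[s_{n,m}](Qm,p) − tₙ^K[s_{n,m′}](Qm,p)| ≤ 4·klIdxMass n m′`. -/
theorem sum_abs_klTransferWeight_compl_sub_le (hK : FrameOK R U N μ K) (hβ : klBetaMin ≤ β) (hβL : β ≤ L) {n m m' : ℕ} (hn : n ≤ m') (h : m' ≤ m)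
    (Qm : TorusSite 2 L) :
    ∑ p, |klTransferWeight L M β μ K n (softSymbolCompl L M β μ K n m) Qm p - klTransferWeight L M β μ K n (softSymbolCompl L M β μ K n m') Qm p| ≤
      4 * klIdxMass n m' :=
  (sum_abs_klTransferWeight_sub_le_klSoftMass β μ K (pos_of_klBetaMin_le hβ) n _ _ Qm).trans
    (mul_le_mul_of_nonneg_left (klSoftMass_compl_sub_compl_le_klIdxMass β μ K hK hβ hβL hn h) (by norm_num))

/-- The coarse form: `Σ_p |tₙ^K[s_{n,m}] − tₙ^K[s_{n,m′}]| ≤ 4·15367`. -/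
theorem sum_abs_klTransferWeight_compl_sub_le_const (hK : FrameOK R U N μ K) (hβ : klBetaMin ≤ β) (hβL : β ≤ L) {n m m' : ℕ} (hn : n ≤ m') (h : m' ≤ m)
    (Qm : TorusSite 2 L) :
    ∑ p, |klTransferWeight L M β μ K n (softSymbolCompl L M β μ K n m) Qm p - klTransferWeight L M β μ K n (softSymbolCompl L M β μ K n m') Qm p| ≤
      4 * 15367 :=
  (sum_abs_klTransferWeight_compl_sub_le β μ K hK hβ hβL hn h Qm).trans (by linarith [klIdxMass_le n m'])

/-- **Smallness of the relative weight** from the U-door: `0 ≤ m`, `m·(4·15367) ≤ 1/3` ⇒ `m·Σ_p |tₙ^K[s_{n,m}] − tₙ^K[s_{n,m′}]| ≤ 1/3`. -/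
theorem mul_sum_abs_klTransferWeight_compl_sub_le_third (hK : FrameOK R U N μ K) (hβ : klBetaMin ≤ β) (hβL : β ≤ L) {n mI m' : ℕ} (hn : n ≤ m') (h : m' ≤ mI)
    (Qm : TorusSite 2 L) {m : ℝ} (hm : 0 ≤ m) (hsm : m * (4 * 15367) ≤ 1 / 3) :
    m * ∑ p, |klTransferWeight L M β μ K n (softSymbolCompl L M β μ K n mI) Qm p - klTransferWeight L M β μ K n (softSymbolCompl L M β μ K n m') Qm p| ≤ 1 / 3 :=
  (mul_le_mul_of_nonneg_left (sum_abs_klTransferWeight_compl_sub_le_const β μ K hK hβ hβL hn h Qm) hm).trans hsm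

end Lines

/-! ## §2 Base-scale readings (n = 0) -/

section Base

/-- At the base scale the prefactor is `r` itself: `klIdxPrefactor r 0 = r`. -/
@[simp] theorem klIdxPrefactor_zero (r : ℝ) : klIdxPrefactor r 0 = r := by
  unfold klIdxPrefactor; norm_num

/-- At the base scale the index mass is `15367·(4^{m′})⁻¹`. -/
theorem klIdxMass_zero (m' : ℕ) : klIdxMass 0 m' = 15367 * ((4 : ℝ) ^ m')⁻¹ := by
  simp [klIdxMass]

variable {L : ℕ}

/-- **The n = 0 bar** k3c2-p1's base clause carries: `transferBarRelIdx … 0 m′ = transferBarRelAtWF L G P r β U 0 (15367·(4^{m′})⁻¹) (klIdxOverlap 0 m′)`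
(`klIdxOverlap 0 m′ = 15367·[m′ = 0]`). -/
theorem transferBarRelIdx_zero (G : GeoConsts) (P : SplitConsts) (r β U : ℝ) (m' : ℕ) (Qm k k' : TorusSite 2 L) :
    transferBarRelIdx L G P r β U 0 m' Qm k k' = transferBarRelAtWF L G P r β U 0 (15367 * ((4 : ℝ) ^ m')⁻¹) (klIdxOverlap 0 m') Qm k k' := by
  rw [transferBarRelIdx_eq, klIdxPrefactor_zero, klIdxMass_zero]

end Base

/-! ## §3 Dispatch of the trivial pairs of the index family -/

section Trivial

variable {L M : ℕ} (β μ : ℝ) (K : TrigPolyC4v)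

/-- **Wick degeneracy**: two indices past the thermal index give the SAME member (`s_{n,m} = s_{n,m′} = 1 − w^K_{Λₙ}` for `m, m′ > nScales β`). -/
theorem softSymbolCompl_eq_of_nScales_lt {β : ℝ} (hβ : 0 < β) (μ : ℝ) (K : TrigPolyC4v) (n : ℕ) {m m' : ℕ} (hm : nScales β < m) (hm' : nScales β < m') :
    softSymbolCompl L M β μ K n m = softSymbolCompl L M β μ K n m' := by
  rw [softSymbolCompl_eq_one_sub_of_nScales_lt hβ μ K n hm, softSymbolCompl_eq_one_sub_of_nScales_lt hβ μ K n hm']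

variable [NeZero L] [NeZero M]

/-- **The DIAGONAL pairs of the index family are free**: `PairTransferRelAt … n (transferBarRelIdx … n m′) s_{n,m} s_{n,m}` for every `m, m′` (`PairTransferRelAt.refl`,
the index bar being nonnegative for `0 ≤ r`, `0 ≤ P.Klam`, `0 ≤ G.CF`) — so the producer owes only the pairs `m′ < m ≤ nScales β + 1` with `s_{n,m} ≠ s_{n,m′}`. -/
theorem pairTransferRelAt_relIdx_refl {G : GeoConsts} (hCF : 0 ≤ G.CF) {P : SplitConsts} (hK : 0 ≤ P.Klam) {r : ℝ} (hr : 0 ≤ r) (β U μ : ℝ) (n m m' : ℕ) :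
    PairTransferRelAt L M β U μ n (transferBarRelIdx L G P r β U n m')
      (softSymbolCompl L M β μ (klFlowFrameU L M β U μ n) n m) (softSymbolCompl L M β μ (klFlowFrameU L M β U μ n) n m) :=
  PairTransferRelAt.refl (fun Qm k k' => transferBarRelIdx_nonneg hCF hK hr β U n m' Qm k k') _

/-- **Pairs of EQUAL members are free** (e.g. both indices past `nScales β`): if `s_{n,m} = s_{n,m′}` then the index clause at `(m, m′)` holds with any `0 ≤ r`. -/
theorem pairTransferRelAt_relIdx_of_eq {G : GeoConsts} (hCF : 0 ≤ G.CF) {P : SplitConsts} (hK : 0 ≤ P.Klam) {r : ℝ} (hr : 0 ≤ r) (β U μ : ℝ) (n : ℕ) {m m' : ℕ}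
    (heq : softSymbolCompl L M β μ (klFlowFrameU L M β U μ n) n m = softSymbolCompl L M β μ (klFlowFrameU L M β U μ n) n m') :
    PairTransferRelAt L M β U μ n (transferBarRelIdx L G P r β U n m')
      (softSymbolCompl L M β μ (klFlowFrameU L M β U μ n) n m) (softSymbolCompl L M β μ (klFlowFrameU L M β U μ n) n m') := by
  rw [heq]
  exact pairTransferRelAt_relIdx_refl hCF hK hr β U μ n m' m'

end Trivial

end Summit.HubbardSuperconductivity.HubbardSuperconductivity.Theorems.KLRegimeSplit

end
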